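import Mathlib
import HarnessLib

/-!
# Taylor enclosures of `arctan` on `[0, 1]`, the `π/4`-reduction, and a Padé minorant of `log (1 + y)`

Stub `stub_arctanLogBounds` for the line *parity–multiplicity–commutator* of the crux
`GroundStateSimpleEven` (Weil ground state). Three elementary facts used to enclose the
closed-form integrals of Lorentzians `c²/(A + u²)` against a polynomial cap:

* (i) `w − w³/3 ≤ arctan w ≤ w − w³/3 + w⁵/5` for `0 ≤ w ≤ 1` (in fact for all `w ≥ 0`), by the
  derivative method: `d/dw [arctan w − (w − w³/3)] = w⁴/(1 + w²) ≥ 0` and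
  `d/dw [(w − w³/3 + w⁵/5) − arctan w] = w⁶/(1 + w²) ≥ 0`, both vanishing at `0`;
* (ii) `arctan y = π/4 + arctan ((y − 1)/(y + 1))` for `y > 0`, from Mathlib's addition formula
  `Real.arctan_add` at `x = 1` (`arctan 1 = π/4`, and `(1 + y')/(1 − y') = y` for
  `y' = (y − 1)/(y + 1)`);
* (iii) the `(1,1)`-Padé lower bound `2y/(2 + y) ≤ log (1 + y)` for `y ≥ 0`, again by
  monotonicity: `d/dy [log (1 + y) − 2y/(2 + y)] = y²/((1 + y)(2 + y)²) ≥ 0`.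
-/

open Set MeasureTheory Filter

open scoped Real Topology

namespace Summit.RiemannHypothesis.RiemannHypothesis.Theorems.GroundStateSimpleEven

set_option linter.dupNamespace false in
/-- Monotonicity on the half-line: if `f 0 = 0` and `f` has a derivative `f' x ≥ 0` at every
`x ≥ 0`, then `0 ≤ f x` for `x ≥ 0`. [folklore] -/
theorem atan_nonneg_of_hasDerivAt_nonneg {f f' : ℝ → ℝ}
    (hf : ∀ x, 0 ≤ x → HasDerivAt f (f' x) x) (h0 : f 0 = 0)
    (hpos : ∀ x, 0 ≤ x → 0 ≤ f' x) {x : ℝ} (hx : 0 ≤ x) : 0 ≤ f x := by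
  have hmono : MonotoneOn f (Ici 0) :=
    monotoneOn_of_deriv_nonneg (convex_Ici 0)
      (fun y hy ↦ (hf y hy).continuousAt.continuousWithinAt)
      (fun y hy ↦ (hf y (interior_subset hy)).differentiableAt.differentiableWithinAt)
      fun y hy ↦ by
        rw [interior_Ici] at hy
        rw [(hf y (le_of_lt hy)).deriv]
        exact hpos y (le_of_lt hy)
  have := hmono (self_mem_Ici (a := (0 : ℝ))) hx hx
  rwa [h0] at this

set_option linter.dupNamespace false in
/-- `d/dw [arctan w − (w − w³/3)] = w⁴/(1 + w²)`. [folklore] -/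
theorem atan_hasDerivAt_arctan_sub_cubic (x : ℝ) :
    HasDerivAt (fun w : ℝ ↦ Real.arctan w - (w - w ^ 3 / 3)) (x ^ 4 / (1 + x ^ 2)) x := by
  have h := (Real.hasDerivAt_arctan x).sub
    ((hasDerivAt_id' x).sub ((hasDerivAt_pow 3 x).div_const 3))
  refine h.congr_deriv ?_
  have hx : (0 : ℝ) < 1 + x ^ 2 := by positivity
  field_simp
  ring

set_option linter.dupNamespace false in
/-- `d/dw [(w − w³/3 + w⁵/5) − arctan w] = w⁶/(1 + w²)`. [folklore] -/
theorem atan_hasDerivAt_quintic_sub_arctan (x : ℝ) :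
    HasDerivAt (fun w : ℝ ↦ w - w ^ 3 / 3 + w ^ 5 / 5 - Real.arctan w)
      (x ^ 6 / (1 + x ^ 2)) x := by
  have h := (((hasDerivAt_id' x).sub ((hasDerivAt_pow 3 x).div_const 3)).add
    ((hasDerivAt_pow 5 x).div_const 5)).sub (Real.hasDerivAt_arctan x)
  refine h.congr_deriv ?_
  have hx : (0 : ℝ) < 1 + x ^ 2 := by positivity
  field_simp
  ring

set_option linter.dupNamespace false in
/-- `d/dy [log (1 + y) − 2y/(2 + y)] = y²/((1 + y)(2 + y)²)` for `y ≥ 0`. [folklore] -/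
theorem atan_hasDerivAt_log_sub_pade {y : ℝ} (hy : 0 ≤ y) :
    HasDerivAt (fun t : ℝ ↦ Real.log (1 + t) - 2 * t / (2 + t))
      (y ^ 2 / ((1 + y) * (2 + y) ^ 2)) y := by
  have h1 : HasDerivAt (fun t : ℝ ↦ 1 + t) 1 y := (hasDerivAt_id' y).const_add 1
  have h2 : HasDerivAt (fun t : ℝ ↦ 2 + t) 1 y := (hasDerivAt_id' y).const_add 2
  have h3 : HasDerivAt (fun t : ℝ ↦ 2 * t) 2 y := by
    simpa using (hasDerivAt_id' y).const_mul (2 : ℝ)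
  have h1y : (1 + y) ≠ 0 := by positivity
  have h2y : (2 + y) ≠ 0 := by positivity
  have h := (h1.log h1y).sub (h3.div h2 h2y)
  refine h.congr_deriv ?_
  field_simp
  ring

end Summit.RiemannHypothesis.RiemannHypothesis.Theorems.GroundStateSimpleEven

namespace Summit.RiemannHypothesis.RiemannHypothesis.Theorems

set_option linter.dupNamespace false in
open GroundStateSimpleEven in
/-- **Elementary `arctan`/`log` bounds.** (i) For `0 ≤ w ≤ 1`,
`w − w³/3 ≤ arctan w ≤ w − w³/3 + w⁵/5` (derivative method: the differences have derivatives
`w⁴/(1 + w²) ≥ 0`, `w⁶/(1 + w²) ≥ 0` and vanish at `0`); (ii) for `y > 0`,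
`arctan y = π/4 + arctan ((y − 1)/(y + 1))` (Mathlib `Real.arctan_add` at `x = 1`);
(iii) for `y ≥ 0`, `2y/(2 + y) ≤ log (1 + y)` (the difference has derivative
`y²/((1 + y)(2 + y)²) ≥ 0` and vanishes at `0`). [folklore] -/
theorem stub_arctanLogBounds :
    (∀ w : ℝ, 0 ≤ w → w ≤ 1 →
        w - w ^ 3 / 3 ≤ Real.arctan w ∧ Real.arctan w ≤ w - w ^ 3 / 3 + w ^ 5 / 5) ∧
      (∀ y : ℝ, 0 < y → Real.arctan y = Real.pi / 4 + Real.arctan ((y - 1) / (y + 1))) ∧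
      (∀ y : ℝ, 0 ≤ y → 2 * y / (2 + y) ≤ Real.log (1 + y)) := by
  refine ⟨fun w hw _ ↦ ⟨?_, ?_⟩, fun y hy ↦ ?_, fun y hy ↦ ?_⟩
  · have h := atan_nonneg_of_hasDerivAt_nonneg (fun x _ ↦ atan_hasDerivAt_arctan_sub_cubic x)
      (by simp) (fun x _ ↦ by positivity) hw
    linarith
  · have h := atan_nonneg_of_hasDerivAt_nonneg (fun x _ ↦ atan_hasDerivAt_quintic_sub_arctan x)
      (by simp) (fun x _ ↦ by positivity) hw
    linarith
  · rw [← Real.arctan_one]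
    have hy1 : y + 1 ≠ 0 := by positivity
    have hlt : (1 : ℝ) * ((y - 1) / (y + 1)) < 1 := by
      rw [one_mul, div_lt_one (by positivity)]
      linarith
    rw [Real.arctan_add hlt]
    congr 1
    have h2 : y + 1 - (y - 1) ≠ 0 := by norm_num
    field_simp
    ring
  · have h := atan_nonneg_of_hasDerivAt_nonneg (fun x hx ↦ atan_hasDerivAt_log_sub_pade hx)
      (by simp) (fun x hx ↦ by positivity) hy
    linarith

end Summit.RiemannHypothesis.RiemannHypothesis.Theorems
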